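import Summits.HodgeConjecture.CorCM.Census.CoinvariantTwist

/-!
# THE TWIST FIBRE LAW: `φ₂(⟨u⟩·B, u^{2ʲ}) + 1 + [∃ b ∈ B, 2ʲ⁺¹ ∣ ord b] = β` for every `j ≥ 0` and every finite group `B`

COR-CM (cell `pub-hodgecm2`), count-neutral kernel combinatorics by the binder seat b09 (gen 33; lane COINVARIANT-TWIST, part II of II),
on top of part I (`Census/CoinvariantTwist.lean`: roots of `c`, `𝒦`, `d₂(G/𝒦) ∈ {0,1}`), the closed form of the coinvariant fibre
(`Census/TypeStabiliserCharK.fibreTwo_add_eq_card_block_add_indexTwoRank`: `φ₂ + 1 + [|G|/2 even] = β + d₂(G/𝒦)`) and THE COINVARIANT FLOOR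
(`Census/CoinvariantFloor.fibreTwo_le_card`), all BY NAME; theorems only (no definition, no `decide`, no certificate, no named fact, no
`sorry`).  HONEST FRAMING: `HC_CM` is NOT proved, here or anywhere in the tree; nothing here is a period or a headline.

THE LAW (§1).  `G` finite with a central `u` of order `2ʲ⁺¹`, `B ≤ G`, `⟨u⟩ ∩ B = 1`, `G = ⟨u⟩·B` (so `G ≅ ℤ/2ʲ⁺¹ × B`, `B` ANY finite
group), `c = u^{2ʲ}`, and `δ := [∃ b ∈ B, 2ʲ⁺¹ ∣ ord b]` (`= [2ʲ⁺¹ ∣ exp B]`, `exists_dvd_orderOf_iff_dvd_exponent`; for `j = 0`: `[|B| even]`):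

  **`φ₂(G, c) + 1 + δ = β(G, c)`**   (`fibreTwo_add_one_eq_card_block` (`δ = 0`), `fibreTwo_add_two_eq_card_block` (`δ = 1`),
                                      `fibreTwo_add_eq_card_block`, `fibreTwo_add_eq_card_block_exponent` (uniform forms)),

from part I (`d₂(G/𝒦) = [j ≥ 1 ∧ δ = 0]`) and `|G|/2 = 2ʲ·|B|` in the closed form, in all four cases `j = 0 / j ≥ 1`, `δ = 0 / 1`.
It contains: `j = 0` — the complemented case `φ₂ + 1 + [|B| even] = β` (`Census/CoinvariantComplementLaw`, b09 gen 31); `j = 1` — the fibre of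
the quartic twist `φ₂ = β − 1 − [∃ t ∈ B, 4 ∣ ord t]` (gen 32ʼs half-parity functional of `Census/QuarticTwistHalfParity.lean` is its concrete
shadow; seat b23ʼs `Census/ClockTypesLaw` screw case); `j ≥ 2` — NEW: the octic, hexadecic, … twists.

THE FLOOR (§2).  With the coinvariant floor: every finite family `S` of integer HODGE vectors whose Galois translates generate the rank-four
faces modulo pairs has **`β ≤ |S| + 1 + δ`** (`card_block_le_card_add_one`, `card_block_le_card_add_two`) — the lower half, for ALL `j`
and all finite `B`, of the lane noteʼs GRAND CONJECTURE (`HOME/pub-hodgecm2-b09/lean-g32/QUARTIC-TWIST.md` PART V)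
`μ_hodge(ℤ/2ʲ⁺¹ × B, (2ʲ,0)) = β − 1 − [∃ t ∈ B, 2ʲ⁺¹ ∣ ord t]`, whose upper half is a kernel theorem for `j = 0` (slices:
`Census/EvenSliceLaw`, `Census/ComplementFaces*`, `Census/OddSlice*`) and `j = 1` (`Census/QuarticTwistLaw` / `…ScrewLaw` / `…NoScrew`) and
open for `j ≥ 2` (octic design v0 and its numerics — potential `Φ(s₀) + Φ(s₁)`, ten residual blocks, residual module with exactly nine
generators, `171 = β − 1` faces generating for `ℤ/8 × ℤ/3` — in the lane note `HOME/pub-hodgecm2-b09/lean-g33/COINVARIANT-TWIST.md`).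

## References
* [Pohlmann1968] H. Pohlmann, Algebraic cycles on abelian varieties of complex multiplication type, Ann. of Math. 88 (1968), Thm 1.
* [Milne1999] J. S. Milne, Lefschetz motives and the Tate conjecture, Compositio Math. 117 (1999), Prop. 2.1, p. 54.
-/

namespace Summit.HodgeConjecture.CorCM.Census.CoinvariantTwist

open Summit.HodgeConjecture.CorCM.Prior.AllgGroup.RfwfAllgGroup
open Summit.HodgeConjecture.CorCM.Census.BlockParity
open Summit.HodgeConjecture.CorCM.Census.Coinvariant
open Summit.HodgeConjecture.CorCM.Census.TypeStabiliser
open Summit.HodgeConjecture.CorCM.Census.IndexTwo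


/-! ## §1 THE TWIST FIBRE LAW `φ₂ + 1 + δ = β` -/

section Law

variable {G : Type*} [Group G] [Fintype G] [DecidableEq G] {u : G} {j : ℕ} {B : Subgroup G}

/-- **THE TWIST FIBRE LAW, `δ = 0`: `φ₂(G, c) + 1 = β(G, c)`** for `G = ⟨u⟩·B` (`u` central of order `2ʲ⁺¹`, `⟨u⟩ ∩ B = 1`),
`c = u^{2ʲ}`, when NO element of `B` has order divisible by `2ʲ⁺¹` (for `j = 0`: `|B|` odd).  Any `j ≥ 0`, any finite `B`. [folklore] -/
theorem fibreTwo_add_one_eq_card_block (hu : ∀ x : G, x * u = u * x) (hord : orderOf u = 2 ^ (j + 1))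
    (hdisj : ∀ g : G, g ∈ Subgroup.zpowers u → g ∈ B → g = 1) (hgen : ∀ g : G, ∃ i : ℕ, ∃ b ∈ B, g = u ^ i * b)
    (hc2 : u ^ 2 ^ j * u ^ 2 ^ j = 1) (hB : ∀ b ∈ B, ¬ 2 ^ (j + 1) ∣ orderOf b) :
    fibreTwo (u ^ 2 ^ j) hc2 + 1 = Fintype.card (Block (u ^ 2 ^ j)) := by
  have key := fibreTwo_add_eq_card_block_add_indexTwoRank (u ^ 2 ^ j) hc2 (c_ne_one hord) (c_comm hu)
  have hcard := card_div_two hord hdisj hgen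
  rcases Nat.eq_zero_or_pos j with hj | hj
  · subst hj
    have hodd : ¬ Even (Fintype.card G / 2) := by
      rw [hcard, pow_zero, one_mul, even_card_iff]
      rintro ⟨b, hb, h2⟩
      exact hB b hb (by rwa [zero_add, pow_one])
    rw [if_neg hodd, indexTwoRank_stabGen_eq_zero_of_eq_zero hord hdisj hgen rfl] at key
    omega
  · have heven : Even (Fintype.card G / 2) := by
      rw [hcard]
      exact (Nat.even_pow.mpr ⟨even_two, by omega⟩).mul_right _
    rw [if_pos heven, indexTwoRank_stabGen_eq_one hu hord hdisj hgen hj hB] at key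
    omega

/-- **THE TWIST FIBRE LAW, `δ = 1`: `φ₂(G, c) + 2 = β(G, c)`** when SOME element of `B` has order divisible by `2ʲ⁺¹` (for `j = 0`:
`|B|` even; for `j = 1`: the SCREW case of the quartic twist; for `j = 2`: `B ∋ t` with `8 ∣ ord t`). [folklore] -/
theorem fibreTwo_add_two_eq_card_block (hu : ∀ x : G, x * u = u * x) (hord : orderOf u = 2 ^ (j + 1))
    (hdisj : ∀ g : G, g ∈ Subgroup.zpowers u → g ∈ B → g = 1) (hgen : ∀ g : G, ∃ i : ℕ, ∃ b ∈ B, g = u ^ i * b)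
    (hc2 : u ^ 2 ^ j * u ^ 2 ^ j = 1) (hB : ∃ b ∈ B, 2 ^ (j + 1) ∣ orderOf b) :
    fibreTwo (u ^ 2 ^ j) hc2 + 2 = Fintype.card (Block (u ^ 2 ^ j)) := by
  have key := fibreTwo_add_eq_card_block_add_indexTwoRank (u ^ 2 ^ j) hc2 (c_ne_one hord) (c_comm hu)
  have hcard := card_div_two hord hdisj hgen
  have heven : Even (Fintype.card G / 2) := by
    rw [hcard]
    rcases Nat.eq_zero_or_pos j with hj | hj
    · subst hj
      rw [pow_zero, one_mul, even_card_iff]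
      obtain ⟨b, hb, h2⟩ := hB
      exact ⟨b, hb, by rwa [zero_add, pow_one] at h2⟩
    · exact (Nat.even_pow.mpr ⟨even_two, by omega⟩).mul_right _
  rw [if_pos heven, indexTwoRank_stabGen_eq_zero_of_exists hu hord hdisj hgen hB] at key
  omega

/-- **THE TWIST FIBRE LAW, uniform form: `φ₂(G, c) + 1 + δ = β(G, c)`, `δ = [∃ b ∈ B, 2ʲ⁺¹ ∣ ord b]`** — every `j ≥ 0`, every
finite `B`. [folklore] -/
theorem fibreTwo_add_eq_card_block (hu : ∀ x : G, x * u = u * x) (hord : orderOf u = 2 ^ (j + 1))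
    (hdisj : ∀ g : G, g ∈ Subgroup.zpowers u → g ∈ B → g = 1) (hgen : ∀ g : G, ∃ i : ℕ, ∃ b ∈ B, g = u ^ i * b)
    (hc2 : u ^ 2 ^ j * u ^ 2 ^ j = 1) [Decidable (∃ b ∈ B, 2 ^ (j + 1) ∣ orderOf b)] :
    fibreTwo (u ^ 2 ^ j) hc2 + 1 + (if ∃ b ∈ B, 2 ^ (j + 1) ∣ orderOf b then 1 else 0) =
      Fintype.card (Block (u ^ 2 ^ j)) := by
  split_ifs with h
  · exact fibreTwo_add_two_eq_card_block hu hord hdisj hgen hc2 h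
  · rw [add_zero]
    exact fibreTwo_add_one_eq_card_block hu hord hdisj hgen hc2 fun b hb hdvd => h ⟨b, hb, hdvd⟩

omit [DecidableEq G] in
/-- `δ` in the EXPONENT currency: some `b ∈ B` has `2ʲ⁺¹ ∣ ord b` iff `2ʲ⁺¹ ∣ exp B`. [folklore] -/
theorem exists_dvd_orderOf_iff_dvd_exponent : (∃ b ∈ B, 2 ^ (j + 1) ∣ orderOf b) ↔ 2 ^ (j + 1) ∣ Monoid.exponent B := by
  constructor
  · rintro ⟨b, hb, h⟩
    refine h.trans ?_
    rw [← Subgroup.orderOf_mk b hb]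
    exact Monoid.order_dvd_exponent _
  · intro h
    obtain ⟨g, hg⟩ := Nat.prime_two.exists_orderOf_eq_pow_factorization_exponent (G := B)
    have hle : j + 1 ≤ (Monoid.exponent B).factorization 2 :=
      (Nat.prime_two.pow_dvd_iff_le_factorization Monoid.exponent_ne_zero_of_finite).mp h
    exact ⟨g, g.2, by rw [Subgroup.orderOf_coe, hg]; exact pow_dvd_pow 2 hle⟩

/-- **THE TWIST FIBRE LAW, exponent form: `φ₂(G, c) + 1 + [2ʲ⁺¹ ∣ exp B] = β(G, c)`.** [folklore] -/
theorem fibreTwo_add_eq_card_block_exponent (hu : ∀ x : G, x * u = u * x) (hord : orderOf u = 2 ^ (j + 1))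
    (hdisj : ∀ g : G, g ∈ Subgroup.zpowers u → g ∈ B → g = 1) (hgen : ∀ g : G, ∃ i : ℕ, ∃ b ∈ B, g = u ^ i * b)
    (hc2 : u ^ 2 ^ j * u ^ 2 ^ j = 1) :
    fibreTwo (u ^ 2 ^ j) hc2 + 1 + (if 2 ^ (j + 1) ∣ Monoid.exponent B then 1 else 0) =
      Fintype.card (Block (u ^ 2 ^ j)) := by
  split_ifs with h
  · exact fibreTwo_add_two_eq_card_block hu hord hdisj hgen hc2 (exists_dvd_orderOf_iff_dvd_exponent.mpr h)
  · rw [add_zero]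
    exact fibreTwo_add_one_eq_card_block hu hord hdisj hgen hc2 fun b hb hdvd =>
      h (exists_dvd_orderOf_iff_dvd_exponent.mp ⟨b, hb, hdvd⟩)

/-! ## §2 THE FLOOR FOR EVERY TWIST: `|S| + 1 + δ ≥ β` for Hodge families -/

/-- **THE TWIST FLOOR, `δ = 0`**: for `G = ⟨u⟩·B`, `c = u^{2ʲ}`, no element of `B` of order divisible by `2ʲ⁺¹`: every finite family
`S` of integer HODGE vectors with `faces ⊆ P₀ + ℤ[G]·S` (`P₀ ⊆ ℤ⟨pairs⟩`) has **`β ≤ |S| + 1`** — the lower half of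
`μ_hodge = β − 1` for these twists (quartic without screw: `Census/QuarticTwistNoScrew`; octic and beyond: open). [folklore] -/
theorem card_block_le_card_add_one (hu : ∀ x : G, x * u = u * x) (hord : orderOf u = 2 ^ (j + 1))
    (hdisj : ∀ g : G, g ∈ Subgroup.zpowers u → g ∈ B → g = 1) (hgen : ∀ g : G, ∃ i : ℕ, ∃ b ∈ B, g = u ^ i * b)
    (hc2 : u ^ 2 ^ j * u ^ 2 ^ j = 1) (hB : ∀ b ∈ B, ¬ 2 ^ (j + 1) ∣ orderOf b)
    (S : Finset (CMF G (u ^ 2 ^ j) →₀ ℤ)) (P₀ : Submodule ℤ (CMF G (u ^ 2 ^ j) →₀ ℤ))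
    (hP₀ : P₀ ≤ Submodule.span ℤ (pairSet (u ^ 2 ^ j)))
    (hS : (S : Set (CMF G (u ^ 2 ^ j) →₀ ℤ)) ⊆ hodgeSpan (u ^ 2 ^ j) hc2)
    (hX : gfaceSet G (u ^ 2 ^ j) hc2 ⊆ ↑(P₀ ⊔ Submodule.span ℤ (translates (u ^ 2 ^ j) S))) :
    Fintype.card (Block (u ^ 2 ^ j)) ≤ S.card + 1 := by
  have h1 := fibreTwo_le_card (u ^ 2 ^ j) hc2 (c_comm hu) S P₀ hP₀ hS hX
  have h2 := fibreTwo_add_one_eq_card_block hu hord hdisj hgen hc2 hB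
  omega

/-- **THE TWIST FLOOR, `δ = 1`**: if some element of `B` has order divisible by `2ʲ⁺¹`, every such family has **`β ≤ |S| + 2`**
(even slices, quartic screws: sharp; octic screws `ℤ/8 × ℤ/8, …`: conjecturally sharp). [folklore] -/
theorem card_block_le_card_add_two (hu : ∀ x : G, x * u = u * x) (hord : orderOf u = 2 ^ (j + 1))
    (hdisj : ∀ g : G, g ∈ Subgroup.zpowers u → g ∈ B → g = 1) (hgen : ∀ g : G, ∃ i : ℕ, ∃ b ∈ B, g = u ^ i * b)
    (hc2 : u ^ 2 ^ j * u ^ 2 ^ j = 1) (hB : ∃ b ∈ B, 2 ^ (j + 1) ∣ orderOf b)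
    (S : Finset (CMF G (u ^ 2 ^ j) →₀ ℤ)) (P₀ : Submodule ℤ (CMF G (u ^ 2 ^ j) →₀ ℤ))
    (hP₀ : P₀ ≤ Submodule.span ℤ (pairSet (u ^ 2 ^ j)))
    (hS : (S : Set (CMF G (u ^ 2 ^ j) →₀ ℤ)) ⊆ hodgeSpan (u ^ 2 ^ j) hc2)
    (hX : gfaceSet G (u ^ 2 ^ j) hc2 ⊆ ↑(P₀ ⊔ Submodule.span ℤ (translates (u ^ 2 ^ j) S))) :
    Fintype.card (Block (u ^ 2 ^ j)) ≤ S.card + 2 := by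
  have h1 := fibreTwo_le_card (u ^ 2 ^ j) hc2 (c_comm hu) S P₀ hP₀ hS hX
  have h2 := fibreTwo_add_two_eq_card_block hu hord hdisj hgen hc2 hB
  omega

end Law

end Summit.HodgeConjecture.CorCM.Census.CoinvariantTwist
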